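import Summits.HodgeConjecture.CorCM.Census.HalfParityFloor
import Summits.HodgeConjecture.CorCM.Census.BlockParityBurnside

/-!
# The half-parity law, VI: the quaternion instance — `G = Q₈`, `c = −1`: `t ≥ 2`, so `φ₂ ≥ β + 1 − δ` (TWO above the parity floor)

COR-CM (cell `pub-hodgecm2`), count-neutral kernel combinatorics by the binder seat b09 (gen 30; lane HALF-PARITY-LAW), part VI:
the emblematic «divided parity» row of the atlas (gen 28 numerics / André-3 PORTFOLIO-g17 §3 row `Q8`: `β = 2`, `δ = 1`, parity floor
`β − 1 − δ = 0`, yet `μ = fibre₂ = 2`), done CENSUS-FREE with parts I–III: `G = QuaternionGroup 2`, `c = a 2 = −1` (central); the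
index-two subgroups `H_A = ⟨a 1⟩ = ⟨i⟩` and `H_B = ⟨xa 0⟩ = ⟨j⟩` both contain `c` and every stabiliser is trivial, so the `H_A`- and
`H_B`-halves `A`, `B` of the two blocks are admissible for the total-parity relation; two faces `f_A`, `f_B` at the type
`{1, i, j, k}`-like corner `T = {a 0, a 1, xa 0, xa 1}` have vanishing block parities and `(hsum A, hsum B)(f_A) = (1, 0)`,
`(hsum A, hsum B)(f_B) = (0, 1)` — a dual family: **`t(Q₈, −1) ≥ 2`** (`two_le_halfRank`) and **`β + 1 ≤ φ₂ + δ`**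
(`card_block_add_one_le_fibreTwo_add_wdelta`), i.e. every family of Hodge vectors generating the faces of a `Q₈`-CM-field modulo pairs
has `|S| ≥ β + 1 − δ` members where the block parities alone give `β − 1 − δ` (`card_block_add_one_le_card_add_wdelta`).  The third
index-two subgroup `⟨k⟩` adds nothing (part II, Klein relation).  All finite checks are `decide` over `|G| = 8`; no enumeration of
types (`sat = everything` via `|sat| = 16 = 2^{|G|/2}`, gen 28 `card_CMF`).  Bookkeeping definitions + theorems; no `Prop`-valued
definition, no named fact, no `sorry`.  HONEST FRAMING: `HC_CM` is NOT proved; nothing here is a period or a headline.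
-/

namespace Summit.HodgeConjecture.CorCM.Census.HalfParity.ExampleQ8

open Finset QuaternionGroup
open Summit.HodgeConjecture.CorCM.Prior.AllgGroup.RfwfAllgGroup
open Summit.HodgeConjecture.CorCM.Census.BlockParity
open Summit.HodgeConjecture.CorCM.Census.Coinvariant

/-- The quaternion group `Q₈ = {a i, xa i | i ∈ ℤ/4}` (`a 1 = i`, `xa 0 = j`). [folklore] -/
abbrev G : Type := QuaternionGroup 2

/-- The central involution `c = a 2 = −1`. [folklore] -/
def c : G := a 2

/-- `c² = 1`. [folklore] -/
theorem c_mul_c : c * c = 1 := by decide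

/-- `c ≠ 1`. [folklore] -/
theorem c_ne_one : c ≠ 1 := by decide

/-- `c` is central. [folklore] -/
theorem c_comm : ∀ x : G, x * c = c * x := by decide

/-- The CM-type test is decidable for explicit `Finset`s. [folklore] -/
instance instDecidableIsCMF : DecidablePred (IsCMF c) := fun Φ => by unfold IsCMF; infer_instance

/-- **`H_A = ⟨i⟩ = {a i}`**, index two, `∋ c`. [folklore] -/
def HA : Subgroup G where
  carrier := {Q | ∃ i : ZMod 4, Q = a i}
  mul_mem' := by
    rintro _ _ ⟨i, rfl⟩ ⟨j, rfl⟩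
    exact ⟨i + j, rfl⟩
  one_mem' := ⟨0, rfl⟩
  inv_mem' := by
    rintro _ ⟨i, rfl⟩
    exact ⟨-i, rfl⟩

/-- Membership in `H_A` is decidable. [folklore] -/
instance instDecidableMemHA : DecidablePred (· ∈ HA) := fun Q => by
  change Decidable (∃ i : ZMod 4, Q = a i); infer_instance

/-- **`H_B = ⟨j⟩ = {a 0, a 2, xa 0, xa 2}`**, index two, `∋ c`. [folklore] -/
def HB : Subgroup G where
  carrier := {Q | Q = a 0 ∨ Q = a 2 ∨ Q = xa 0 ∨ Q = xa 2}
  mul_mem' := by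
    intro p q hp hq
    simp only [Set.mem_setOf_eq] at hp hq ⊢
    revert hp hq; revert p q; decide
  one_mem' := by simp only [Set.mem_setOf_eq]; decide
  inv_mem' := by
    intro p hp
    simp only [Set.mem_setOf_eq] at hp ⊢
    revert hp; revert p; decide

/-- Membership in `H_B` is decidable. [folklore] -/
instance instDecidableMemHB : DecidablePred (· ∈ HB) := fun Q => by
  change Decidable (Q = a 0 ∨ Q = a 2 ∨ Q = xa 0 ∨ Q = xa 2); infer_instance

/-- `c ∈ H_A`, `c ∈ H_B`. [folklore] -/
theorem c_mem : c ∈ HA ∧ c ∈ HB := ⟨⟨2, rfl⟩, by decide⟩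

/-- `H_A` and `H_B` have index two. [folklore] -/
theorem index_eq_two : HA.index = 2 ∧ HB.index = 2 :=
  ⟨Subgroup.index_eq_two_iff.mpr ⟨xa 0, by decide⟩, Subgroup.index_eq_two_iff.mpr ⟨a 1, by decide⟩⟩

/-- The corner type `T = {a 0, a 1, xa 0, xa 1}` (in both half-sets). [folklore] -/
def T : CMF G c := ⟨{a 0, a 1, xa 0, xa 1}, by decide⟩
/-- `T` flipped at the place of `xa 0`. [folklore] -/
def TfX : CMF G c := ⟨{a 0, a 1, xa 1, xa 2}, by decide⟩
/-- `T` flipped at the place of `a 0`. [folklore] -/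
def TfA : CMF G c := ⟨{a 1, a 2, xa 0, xa 1}, by decide⟩
/-- `T` flipped at the places of `a 0` and `xa 0`. [folklore] -/
def TfAX : CMF G c := ⟨{a 1, a 2, xa 1, xa 2}, by decide⟩
/-- `T` flipped at the place of `a 1`. [folklore] -/
def TfB : CMF G c := ⟨{a 0, a 3, xa 0, xa 1}, by decide⟩
/-- `T` flipped at the places of `a 0` and `a 1`. [folklore] -/
def TfAB : CMF G c := ⟨{a 2, a 3, xa 0, xa 1}, by decide⟩
/-- A type of the half-sets. [folklore] -/
def U1 : CMF G c := ⟨{a 0, a 1, xa 0, xa 3}, by decide⟩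
/-- A type of `A`. [folklore] -/
def U2 : CMF G c := ⟨{a 0, a 3, xa 0, xa 3}, by decide⟩
/-- A type of `A`. [folklore] -/
def U3 : CMF G c := ⟨{a 0, a 3, xa 2, xa 3}, by decide⟩
/-- A type of `A` and `B`. [folklore] -/
def U4 : CMF G c := ⟨{a 2, a 3, xa 1, xa 2}, by decide⟩
/-- A type of `A` and `B`. [folklore] -/
def U5 : CMF G c := ⟨{a 2, a 3, xa 2, xa 3}, by decide⟩
/-- A type of `B`. [folklore] -/
def U6 : CMF G c := ⟨{a 0, a 3, xa 1, xa 2}, by decide⟩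
/-- A type of `B`. [folklore] -/
def U7 : CMF G c := ⟨{a 1, a 2, xa 0, xa 3}, by decide⟩
/-- A type of `B`. [folklore] -/
def U8 : CMF G c := ⟨{a 2, a 3, xa 0, xa 3}, by decide⟩

/-- **`A`** = the `H_A`-orbits of one representative of each block. [folklore] -/
def A : Finset (CMF G c) := {T, U1, U2, U3, TfA, TfAX, U4, U5}

/-- **`B`** = the `H_B`-orbits of the same representatives. [folklore] -/
def B : Finset (CMF G c) := {T, U1, TfX, U6, U7, U8, U4, U5}

/-- `A` is a half-block set of `H_A`. [folklore] -/
theorem A_half : (∀ Q ∈ HA, ∀ Ψ ∈ A, rt c Q Ψ ∈ A) ∧ ∀ Q ∉ HA, ∀ Ψ ∈ A, rt c Q Ψ ∉ A := by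
  constructor <;> decide

/-- `B` is a half-block set of `H_B`. [folklore] -/
theorem B_half : (∀ Q ∈ HB, ∀ Ψ ∈ B, rt c Q Ψ ∈ B) ∧ ∀ Q ∉ HB, ∀ Ψ ∈ B, rt c Q Ψ ∉ B := by
  constructor <;> decide

/-- `|sat A| = |sat B| = 16`. [folklore] -/
theorem card_sat : (sat c A).card = 16 ∧ (sat c B).card = 16 := by
  constructor <;> decide

/-- A set of `16 = 2^{|G|/2}` types is every type. [folklore] -/
theorem mem_of_card_eq {S : Finset (CMF G c)} (hS : S.card = 16) (Ψ : CMF G c) : Ψ ∈ S := by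
  classical
  haveI : Fintype (CMF G c) := Fintype.ofFinite _
  have hcard : S.card = Fintype.card (CMF G c) := by
    rw [hS, ← Nat.card_eq_fintype_card, card_CMF c c_mul_c c_ne_one]
    rfl
  rw [Finset.eq_univ_of_card _ hcard]
  exact Finset.mem_univ Ψ

/-- **`A` and `B` are admissible** (total-parity relation). [folklore] -/
theorem mem_admHalves : A ∈ admHalves c c_mul_c ∧ B ∈ admHalves c c_mul_c :=
  ⟨mem_admHalves_of c c_mul_c index_eq_two.1 c_mem.1 A_half.1 A_half.2
      (face2_le_ker_hsum_sat_of_forall_mem c (mem_of_card_eq card_sat.1)),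
    mem_admHalves_of c c_mul_c index_eq_two.2 c_mem.2 B_half.1 B_half.2
      (face2_le_ker_hsum_sat_of_forall_mem c (mem_of_card_eq card_sat.2))⟩

/-- The witness face `f_A = gface T (a 0) (xa 0) = [T] + [TfAX] − [TfA] − [TfX]`. [folklore] -/
theorem gface_A : gface c c_mul_c T (a 0) (xa 0) =
    Finsupp.single T 1 + Finsupp.single TfAX 1 - Finsupp.single TfA 1 - Finsupp.single TfX 1 := by
  have h2 : oflipCM c c_mul_c (xa 0) T = TfX := Subtype.ext (by decide)
  have h3 : oflipCM c c_mul_c (a 0) T = TfA := Subtype.ext (by decide)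
  have h4 : oflipCM c c_mul_c (a 0) (oflipCM c c_mul_c (xa 0) T) = TfAX := by rw [h2]; exact Subtype.ext (by decide)
  unfold gface
  rw [h4, h3, h2]

/-- The witness face `f_B = gface T (a 0) (a 1) = [T] + [TfAB] − [TfA] − [TfB]`. [folklore] -/
theorem gface_B : gface c c_mul_c T (a 0) (a 1) =
    Finsupp.single T 1 + Finsupp.single TfAB 1 - Finsupp.single TfA 1 - Finsupp.single TfB 1 := by
  have h2 : oflipCM c c_mul_c (a 1) T = TfB := Subtype.ext (by decide)
  have h3 : oflipCM c c_mul_c (a 0) T = TfA := Subtype.ext (by decide)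
  have h4 : oflipCM c c_mul_c (a 0) (oflipCM c c_mul_c (a 1) T) = TfAB := by rw [h2]; exact Subtype.ext (by decide)
  unfold gface
  rw [h4, h3, h2]

/-- The places used are distinct. [folklore] -/
theorem notMem_orb : xa 0 ∉ orb c (a 0) ∧ a 1 ∉ orb c (a 0) := by constructor <;> decide

/-- The corners pair up in blocks: `TfAX = T·(a 3)⁻¹`, `TfX = TfA·(xa 1)⁻¹`, `TfAB = T·(xa 3)⁻¹`, `TfB = TfA·(xa 0)⁻¹`. [folklore] -/
theorem corners_rt : TfAX = rt c (a 3) T ∧ TfX = rt c (xa 1) TfA ∧ TfAB = rt c (xa 3) T ∧ TfB = rt c (xa 0) TfA :=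
  ⟨Subtype.ext (by decide), Subtype.ext (by decide), Subtype.ext (by decide), Subtype.ext (by decide)⟩

/-- `u + u − v − v = 0` in `𝔽₂^{blocks}`. [folklore] -/
theorem add_self_sub_sub (u v : Block c → ZMod 2) : u + u - v - v = 0 := by
  funext b
  simp only [Pi.sub_apply, Pi.add_apply, Pi.zero_apply]
  generalize u b = p; generalize v b = q; revert p q; decide

/-- **Both witnesses have vanishing block parities.** [folklore] -/
theorem par2_witness : par2 c (red c (gface c c_mul_c T (a 0) (xa 0))) = 0 ∧ par2 c (red c (gface c c_mul_c T (a 0) (a 1))) = 0 := by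
  constructor
  · rw [par2_red, gface_A, map_sub, map_sub, map_add, par_single, par_single, par_single, par_single, corners_rt.1,
      corners_rt.2.1, blk_rt, blk_rt]
    simp only [one_smul]
    exact add_self_sub_sub _ _
  · rw [par2_red, gface_B, map_sub, map_sub, map_add, par_single, par_single, par_single, par_single, corners_rt.2.2.1,
      corners_rt.2.2.2, blk_rt, blk_rt]
    simp only [one_smul]
    exact add_self_sub_sub _ _

/-- **The dual table**: `(hsum A, hsum B)(f_A) = (1, 0)` and `(hsum A, hsum B)(f_B) = (0, 1)`. [folklore] -/
theorem hsum_witness :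
    hsum c A (red c (gface c c_mul_c T (a 0) (xa 0))) = 1 ∧ hsum c B (red c (gface c c_mul_c T (a 0) (xa 0))) = 0 ∧
      hsum c A (red c (gface c c_mul_c T (a 0) (a 1))) = 0 ∧ hsum c B (red c (gface c c_mul_c T (a 0) (a 1))) = 1 := by
  rw [gface_A, gface_B]
  simp only [map_sub, map_add, red_single, hsum_single, Int.cast_one]
  decide

/-- The witnesses are Hodge vectors mod `2` (faces). [folklore] -/
theorem witness_mem_hodge2 : red c (gface c c_mul_c T (a 0) (xa 0)) ∈ hodge2 c c_mul_c ∧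
    red c (gface c c_mul_c T (a 0) (a 1)) ∈ hodge2 c c_mul_c :=
  ⟨Submodule.mem_sup_left (Submodule.subset_span (red_mem_faces2 c c_mul_c ⟨T, a 0, xa 0, notMem_orb.1, rfl⟩)),
    Submodule.mem_sup_left (Submodule.subset_span (red_mem_faces2 c c_mul_c ⟨T, a 0, a 1, notMem_orb.2, rfl⟩))⟩

/-- **`t(Q₈, −1) ≥ 2`**: the half-parities along `⟨i⟩` and `⟨j⟩` are two independent NEW invariant functionals on the coinvariant
fibre. [folklore] -/
theorem two_le_halfRank : 2 ≤ halfRank c c_mul_c := by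
  obtain ⟨hm1, hm2⟩ := witness_mem_hodge2
  obtain ⟨hp1, hp2⟩ := par2_witness
  obtain ⟨h1, h2, h3, h4⟩ := hsum_witness
  have h := le_halfRank_of_dual_family c c_mul_c (ι := Fin 2) ![A, B]
    (fun i => by fin_cases i <;> [simpa using mem_admHalves.1; simpa using mem_admHalves.2])
    ![red c (gface c c_mul_c T (a 0) (xa 0)), red c (gface c c_mul_c T (a 0) (a 1))]
    (fun j => by fin_cases j <;> [simpa using hm1; simpa using hm2]) (fun j => by fin_cases j <;> [simpa using hp1; simpa using hp2])
    (fun i j => by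
      fin_cases i <;> fin_cases j <;> [simpa using h1; simpa using h3; simpa using h2; simpa using h4])
  simpa using h

/-- **`β + 1 ≤ φ₂ + δ` on `(Q₈, −1)`**: the coinvariant fibre is TWO above the parity floor `β − 1 − δ` (André-3 / gen 28:
`β = 2`, `δ = 1`, `φ₂ = 2`, floor `0`) — census-free. [folklore] -/
theorem card_block_add_one_le_fibreTwo_add_wdelta (T₀ : CMF G c) :
    Fintype.card (Block c) + 1 ≤ fibreTwo c c_mul_c + wdelta c T₀ := by
  have h1 := card_block_add_halfRank_le_fibreTwo_add c c_mul_c T₀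
  have h2 := two_le_halfRank
  omega

/-- **Family form**: every family `S` of integer Hodge vectors whose base changes generate the faces of `(Q₈, −1)` modulo pairs has
`|S| + δ ≥ β + 1` — two more than the block-parity law. [folklore] -/
theorem card_block_add_one_le_card_add_wdelta (T₀ : CMF G c) (S : Finset (CMF G c →₀ ℤ))
    (P₀ : Submodule ℤ (CMF G c →₀ ℤ)) (hP₀ : P₀ ≤ Submodule.span ℤ (pairSet c))
    (hS : (S : Set (CMF G c →₀ ℤ)) ⊆ hodgeSpan c c_mul_c)
    (hX : gfaceSet G c c_mul_c ⊆ ↑(P₀ ⊔ Submodule.span ℤ (translates c S))) :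
    Fintype.card (Block c) + 1 ≤ S.card + wdelta c T₀ := by
  have h1 := card_block_add_halfRank_le_card_add c c_mul_c c_comm T₀ S P₀ hP₀ hS hX
  have h2 := two_le_halfRank
  omega


/-! ## Appendix (gen 30, same session): `β ≥ 2`, hence `φ₂ ≥ 2` and every generating Hodge family has at least two members -/

/-- The two block representatives `T`, `U1` are inequivalent under base change. [folklore] -/
theorem blk_ne : blk c T ≠ blk c U1 := by
  intro h
  obtain ⟨Q, hQ⟩ := exists_rt_eq_of_blk_eq c h
  revert Q
  decide

/-- **`β(Q₈, −1) ≥ 2`** (André-3 / gen 28: `β = 2`). [folklore] -/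
theorem two_le_card_block : 2 ≤ Fintype.card (Block c) :=
  Fintype.one_lt_card_iff_nontrivial.mpr ⟨⟨blk c T, blk c U1, blk_ne⟩⟩

/-- **`φ₂(Q₈, −1) ≥ 2`** — census-free; the block-parity floor alone gives `0`; André-3's `μ = fibre₂ = 2` is attained as a lower
bound (and two faces DO generate: seat b23/b30's octic quaternion census transport). [folklore] -/
theorem two_le_fibreTwo : 2 ≤ fibreTwo c c_mul_c := by
  have h1 := card_block_add_one_le_fibreTwo_add_wdelta T
  have h2 := two_le_card_block
  have h3 := wdelta_le_one c T
  omega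

/-- **Every family of integer Hodge vectors whose base changes generate the faces of `(Q₈, −1)` modulo pairs has at least TWO
members** (`μ(Q₈) ≥ 2`). [folklore] -/
theorem two_le_card (S : Finset (CMF G c →₀ ℤ)) (P₀ : Submodule ℤ (CMF G c →₀ ℤ)) (hP₀ : P₀ ≤ Submodule.span ℤ (pairSet c))
    (hS : (S : Set (CMF G c →₀ ℤ)) ⊆ hodgeSpan c c_mul_c) (hX : gfaceSet G c c_mul_c ⊆ ↑(P₀ ⊔ Submodule.span ℤ (translates c S))) :
    2 ≤ S.card := by
  have h1 := card_block_add_one_le_card_add_wdelta T S P₀ hP₀ hS hX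
  have h2 := two_le_card_block
  have h3 := wdelta_le_one c T
  omega

end Summit.HodgeConjecture.CorCM.Census.HalfParity.ExampleQ8
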